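import Summits.AtomisticToContinuum.FouriersLaw.Theorems.BondHeatUncertaintyExtensiveSnapshotIrreversibilityOddLogDensityOfOddRegularityAux1
import HarnessLib

/-!
# Crux `ExtensiveSnapshotIrreversibility` (stmt-AtomisticToContinuum-9121), line `clausius-budget-sound-window`:
stub S1g' `stub_oddLogDensity_of_oddRegularity`

Registered stub of the lead's checked skeleton (v8) of the line, proved verbatim (name + signature).

Content (fixed `N ≥ 2`, soft analysis). For the pinned anharmonic chain `P = pinnedChain ω₂ lam β γ`
with both baths near `T > 0`, let `μ_δ = μ_{N,T+δ/2,T−δ/2}` be the steady-state family,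
`μ_T = P.gibbsMeasure N T` the Gibbs state (`= μ_{N,T,T}` under weak-NESS uniqueness) and
`Θ(q, p) = (q, −p)` the momentum flip. The ODD regularity statement (R') of the NESS log-density —
`μ_δ = μ_T · e^{φ_δ}` for small `δ ≠ 0` with the UPPER bound (R2u) `φ_δ ≤ η(1 + H)`, `η < 1/(4T)`,
(R0) `φ_δ → 0` pointwise, the odd bound (R3o) `|φ_δ − φ_δ∘Θ| ≤ C|δ|(1 + H)^k` and the odd
derivative (R4o) `(φ_δ − φ_δ∘Θ)/δ → d₀` pointwise — implies the quadratic-mean first-order control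
(S1d) of the odd log-density: for every `L²` linear-response density `h` of the family at `δ = 0` and
every `D > ∫ (h − h∘Θ)² dμ_{N,T,T}`, eventually in `δ ≠ 0` the state `μ_δ` has an everywhere positive
measurable Lebesgue density `ρ_δ` with `∫ (log ρ_δ − log ρ_δ∘Θ)² dμ_δ ≤ D δ²`.  This is the v8
weakening of the landed S1g `stub_oddLogDensity_of_regularity` (two-sided bounds, `φ_δ/δ → h₀`).

Proof. `ρ_δ := e^{φ_δ} e^{−H/T}/Z`, `log ρ_δ − log ρ_δ∘Θ = φ_δ − φ_δ∘Θ =: d_δ` (`H∘Θ = H`), and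
`∫ d_δ² dμ_δ = δ² ∫ (d_δ/δ)² e^{φ_δ} dμ_T → δ²·∫ d₀² dμ_T` by dominated convergence (bound
`C²(1 + H)^{2k} e^{η(1+H)} ∈ L¹(μ_T)`; only the upper bound (R2u) enters).  Identification of `d₀`:
testing the response hypothesis on `F` and on `F∘Θ` (`F ∈ C_c^∞`) and using the flip-invariance of
`μ_T` (`gibbsMeasure_map_flip`),
`δ⁻¹(∫ (F − F∘Θ) dμ_δ − ∫ (F − F∘Θ) dμ_T) = ∫ F (e^{φ_δ} − e^{φ_δ∘Θ})/δ dμ_T → ∫ F (h − h∘Θ) dμ_T`,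
while pointwise `(e^{φ_δ} − e^{φ_δ∘Θ})/δ = e^{φ_δ∘Θ}(e^{d_δ} − 1)/δ → d₀` with the domination
`|e^a − e^b| ≤ e^{max(a,b)}|a − b| ≤ e^{η(1+H)} C(1 + H)^k`, so the same quotient tends to
`∫ F d₀ dμ_T`; weak derivatives being unique a.e. (`OddLogDensity.ae_eq_of_tendsto_testFunction`),
`d₀ = h − h∘Θ` `μ_T`-a.e. and `∫ d₀² dμ_T = ∫ (h − h∘Θ)² dμ_{N,T,T} < D`.  The two odd
dominated-convergence lemmas and the closed form of the odd difference quotient live in the helper file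
`…OddLogDensityOfOddRegularityAux1` (registered sub-goal `oddLogDensity_oddQuadraticMeanLimit`); the
a.e. uniqueness of weak derivatives and the density bookkeeping are reused from the landed S1g file.

References: J. A. McLennan, Phys. Rev. 115 (1959) 1405; C. Maes, K. Netočný, J. Math. Phys. 51 (2010)
015219, Thm 3.1 (the McLennan/linear-response log-density). No new definitions.
-/

noncomputable section

namespace Summit.AtomisticToContinuum.FouriersLaw.Theorems.ExtensiveSnapshotIrreversibility.ClausiusBudget

open MeasureTheory Filter Topology
open scoped ENNReal NNReal
open Literature.MathematicalPhysics.KineticTheory.HeatConduction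
open Summit.AtomisticToContinuum.FouriersLaw.Theorems.ExtensiveSnapshotIrreversibility.Negative
open Summit.AtomisticToContinuum.FouriersLaw.Theorems.ExtensiveSnapshotIrreversibility.ClausiusBudget.OddLogDensity

/-! ## The stub -/

/-- **S1g' `stub_oddLogDensity_of_oddRegularity`** (crux `ExtensiveSnapshotIrreversibility`, line
`clausius-budget-sound-window`; fixed `N ≥ 2`). The ODD regularity statement (R') of the NESS
log-density (for the family `μ`, `T > 0`, `N ≥ 2`: `δ₀ > 0`, `0 < η < 1/(4T)`, `C`, `k`, measurable
`φ_δ`, `d₀` with `μ_{N,T+δ/2,T−δ/2} = μ_T · e^{φ_δ}` for `0 < |δ| < δ₀`, `φ_δ ≤ η(1 + H)`,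
`φ_δ → 0` pointwise, `|φ_δ − φ_δ∘Θ| ≤ C|δ|(1 + H)^k`, `(φ_δ − φ_δ∘Θ)/δ → d₀` pointwise) IMPLIES S1d
verbatim: under weak-NESS uniqueness, along every steady-state family, for `T > 0`, `N ≥ 2`, every
`L²` linear-response density `h` (weak `δ`-derivative at `δ = 0` tested on `C_c^∞` observables and on
the bond currents) and every `D > ∫ (h − h∘Θ)² dμ_{N,T,T}`: eventually in `δ ≠ 0` the steady state has
an everywhere positive measurable Lebesgue density `ρ_δ` with `(log ρ_δ − log ρ_δ∘Θ)² ∈ L¹(μ_δ)` and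
`∫ (log ρ_δ − log ρ_δ∘Θ)² dμ_δ ≤ D δ²`.
Proof: `ρ_δ = e^{φ_δ} e^{−H/T}/Z`, `log ρ_δ − log ρ_δ∘Θ = φ_δ − φ_δ∘Θ`; dominated convergence
`δ⁻² ∫ (φ_δ − φ_δ∘Θ)² e^{φ_δ} dμ_T → ∫ d₀² dμ_T`; testing the response hypothesis on `F − F∘Θ`
(`F ∈ C_c^∞`) and differentiating `∫ F (e^{φ_δ} − e^{φ_δ∘Θ}) dμ_T` under the integral sign shows
that `d₀` and `h − h∘Θ` are weak derivatives of the same quotients, hence `d₀ = h − h∘Θ` `μ_T`-a.e.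
and the limit is `∫ (h − h∘Θ)² dμ_{N,T,T} < D` (`μ_{N,T,T} = μ_T` by uniqueness +
`pinnedChain_isSteadyState_gibbsMeasure`). (McLennan 1959; Maes–Netočný 2010, Thm 3.1.) [folklore] -/
theorem stub_oddLogDensity_of_oddRegularity :
    (∀ ω₂ lam β γ : ℝ, 0 < ω₂ → 0 < lam → 0 < β → 0 < γ →
      (∀ (N : ℕ) (T_L T_R : ℝ), 0 < T_L → 0 < T_R → ∀ μ ν : Measure (PhaseSpace N),
        (pinnedChain ω₂ lam β γ).IsSteadyState N T_L T_R μ →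
        (pinnedChain ω₂ lam β γ).IsSteadyState N T_L T_R ν → μ = ν) →
      ∀ μ : (N : ℕ) → ℝ → ℝ → Measure (PhaseSpace N),
        (∀ (N : ℕ) (T_L T_R : ℝ), 0 < T_L → 0 < T_R →
          (pinnedChain ω₂ lam β γ).IsSteadyState N T_L T_R (μ N T_L T_R)) →
        ∀ T : ℝ, 0 < T → ∀ N : ℕ, 2 ≤ N →
          ∃ δ₀ η C : ℝ, ∃ k : ℕ, 0 < δ₀ ∧ 0 < η ∧ η < 1 / (4 * T) ∧
          ∃ φ : ℝ → PhaseSpace N → ℝ, ∃ d₀ : PhaseSpace N → ℝ,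
            (∀ δ : ℝ, Measurable (φ δ)) ∧ Measurable d₀ ∧
            (∀ δ : ℝ, δ ≠ 0 → |δ| < δ₀ →
              μ N (T + δ / 2) (T - δ / 2) =
                ((pinnedChain ω₂ lam β γ).gibbsMeasure N T).withDensity
                  (fun x => ENNReal.ofReal (Real.exp (φ δ x)))) ∧
            (∀ δ : ℝ, |δ| < δ₀ → ∀ x : PhaseSpace N,
              φ δ x ≤ η * (1 + (pinnedChain ω₂ lam β γ).hamiltonian N x)) ∧
            (∀ x : PhaseSpace N, Tendsto (fun δ : ℝ => φ δ x) (𝓝[≠] (0 : ℝ)) (𝓝 0)) ∧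
            (∀ δ : ℝ, |δ| < δ₀ → ∀ x : PhaseSpace N,
              |φ δ x - φ δ (x.1, -x.2)| ≤
                C * |δ| * (1 + (pinnedChain ω₂ lam β γ).hamiltonian N x) ^ k) ∧
            (∀ x : PhaseSpace N,
              Tendsto (fun δ : ℝ => (φ δ x - φ δ (x.1, -x.2)) / δ) (𝓝[≠] (0 : ℝ)) (𝓝 (d₀ x)))) →
    ∀ ω₂ lam β γ : ℝ, 0 < ω₂ → 0 < lam → 0 < β → 0 < γ →
      (∀ (N : ℕ) (T_L T_R : ℝ), 0 < T_L → 0 < T_R → ∀ μ ν : Measure (PhaseSpace N),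
        (pinnedChain ω₂ lam β γ).IsSteadyState N T_L T_R μ →
        (pinnedChain ω₂ lam β γ).IsSteadyState N T_L T_R ν → μ = ν) →
      ∀ μ : (N : ℕ) → ℝ → ℝ → Measure (PhaseSpace N),
        (∀ (N : ℕ) (T_L T_R : ℝ), 0 < T_L → 0 < T_R →
          (pinnedChain ω₂ lam β γ).IsSteadyState N T_L T_R (μ N T_L T_R)) →
        ∀ T : ℝ, 0 < T → ∀ N : ℕ, 2 ≤ N → ∀ h : PhaseSpace N → ℝ,
          (MemLp h 2 (μ N T T) ∧
            (∀ F : PhaseSpace N → ℝ, ContDiff ℝ ((⊤ : ℕ∞) : WithTop ℕ∞) F → HasCompactSupport F →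
              Tendsto (fun δ : ℝ => ((∫ x, F x ∂(μ N (T + δ / 2) (T - δ / 2))) - ∫ x, F x ∂(μ N T T)) / δ)
                (𝓝[≠] (0 : ℝ)) (𝓝 (∫ x, F x * h x ∂(μ N T T)))) ∧
            (∀ i : Fin N, Tendsto (fun δ : ℝ =>
                ((∫ x, (pinnedChain ω₂ lam β γ).bondCurrent N i x ∂(μ N (T + δ / 2) (T - δ / 2))) -
                  ∫ x, (pinnedChain ω₂ lam β γ).bondCurrent N i x ∂(μ N T T)) / δ)
                (𝓝[≠] (0 : ℝ)) (𝓝 (∫ x, (pinnedChain ω₂ lam β γ).bondCurrent N i x * h x ∂(μ N T T))))) →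
          ∀ D : ℝ, ∫ x, (h x - h (x.1, -x.2)) ^ 2 ∂(μ N T T) < D →
            ∀ᶠ δ in 𝓝[≠] (0 : ℝ), ∃ ρ : PhaseSpace N → ℝ, Measurable ρ ∧ (∀ x, 0 < ρ x) ∧
              μ N (T + δ / 2) (T - δ / 2) =
                (volume : Measure (PhaseSpace N)).withDensity (fun x => ENNReal.ofReal (ρ x)) ∧
              Integrable (fun x => (Real.log (ρ x) - Real.log (ρ (x.1, -x.2))) ^ 2)
                (μ N (T + δ / 2) (T - δ / 2)) ∧
              ∫ x, (Real.log (ρ x) - Real.log (ρ (x.1, -x.2))) ^ 2 ∂(μ N (T + δ / 2) (T - δ / 2))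
                ≤ D * δ ^ 2 := by
  intro hR ω₂ lam β γ hω hl hβ hγ hU μ hμ T hT N hN h hh D hD
  obtain ⟨δ₀, η, C, k, hδ₀, -, hη4, φ, d₀, hφm, hd₀m, hR1, hR2, hR0, hR3, hR4⟩ :=
    hR ω₂ lam β γ hω hl hβ hγ hU μ hμ T hT N hN
  set P := pinnedChain ω₂ lam β γ with hP
  set μT := P.gibbsMeasure N T with hμT
  haveI : IsProbabilityMeasure μT := pinnedChain_isProbabilityMeasure_gibbsMeasure hω hl.le hβ.le γ N hT
  -- (0) `μ N T T = μ_T`; `η < 1/T`; flip-invariance of `μ_T`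
  have hG : μ N T T = μT :=
    hU N T T hT hT _ _ (hμ N T T hT hT) (pinnedChain_isSteadyState_gibbsMeasure hω hl.le hβ.le γ N hT)
  have hηT : η < 1 / T :=
    hη4.trans_le (one_div_le_one_div_of_le hT (by linarith))
  have hmp : MeasurePreserving (momentumReversal N) μT μT :=
    ⟨(momentumReversal N).measurable, gibbsMeasure_map_flip P N T⟩
  -- (1) `d₀, h, h∘Θ ∈ L¹(μ_T)`
  have hd₀i : Integrable d₀ μT :=
    integrable_of_abs_le_mul_one_add_pow hω hl.le hβ.le γ N hT hd₀m.aestronglyMeasurable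
      (fun x => abs_le_of_tendsto_div hδ₀ (hR4 x) (fun δ hδ => hR3 δ hδ x))
  have hhi : Integrable h μT := by
    have := hh.1
    rw [hG] at this
    exact this.integrable one_le_two
  have hhΘi : Integrable (fun x => h (x.1, -x.2)) μT :=
    (hmp.integrable_comp_emb (momentumReversal N).measurableEmbedding).mpr hhi
  have hhoi : Integrable (fun x => h x - h (x.1, -x.2)) μT := hhi.sub hhΘi
  -- (2) `d₀` and `h − h∘Θ` are weak derivatives of the same odd difference quotients
  have hclause₀ : ∀ F : PhaseSpace N → ℝ, ContDiff ℝ ((⊤ : ℕ∞) : WithTop ℕ∞) F → HasCompactSupport F →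
      Tendsto (fun δ : ℝ => ((∫ x, F x ∂(μ N (T + δ / 2) (T - δ / 2))) - ∫ x, F x ∂μT) / δ -
          ((∫ x, F (x.1, -x.2) ∂(μ N (T + δ / 2) (T - δ / 2))) - ∫ x, F (x.1, -x.2) ∂μT) / δ)
        (𝓝[≠] (0 : ℝ)) (𝓝 (∫ x, F x * d₀ x ∂μT)) := by
    intro F hF hFc
    refine (tendsto_integral_mul_expFlipQuot hω hl.le hβ.le γ N hT hδ₀ hηT hφm hR2 hR3 hR0 hR4
      hF.continuous hFc).congr' ?_
    filter_upwards [eventually_ne_and_abs_lt hδ₀] with δ hδ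
    exact (oddDiffQuot_eq_integral hω hl.le hβ.le γ N hT hηT hφm hR2
      (ν := fun δ => μ N (T + δ / 2) (T - δ / 2)) hR1 hF.continuous hFc hδ.1 hδ.2).symm
  have hclause : ∀ F : PhaseSpace N → ℝ, ContDiff ℝ ((⊤ : ℕ∞) : WithTop ℕ∞) F → HasCompactSupport F →
      Tendsto (fun δ : ℝ => ((∫ x, F x ∂(μ N (T + δ / 2) (T - δ / 2))) - ∫ x, F x ∂μT) / δ -
          ((∫ x, F (x.1, -x.2) ∂(μ N (T + δ / 2) (T - δ / 2))) - ∫ x, F (x.1, -x.2) ∂μT) / δ)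
        (𝓝[≠] (0 : ℝ)) (𝓝 (∫ x, F x * (h x - h (x.1, -x.2)) ∂μT)) := by
    intro F hF hFc
    have hFΘ : ContDiff ℝ ((⊤ : ℕ∞) : WithTop ℕ∞) (fun x : PhaseSpace N => F (x.1, -x.2)) :=
      hF.comp (contDiff_fst.prodMk contDiff_snd.neg)
    have hFΘc : HasCompactSupport (fun x : PhaseSpace N => F (x.1, -x.2)) :=
      hFc.comp_homeomorph ((Homeomorph.refl (Fin N → ℝ)).prodCongr (Homeomorph.neg (Fin N → ℝ)))
    have t1 := hh.2.1 F hF hFc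
    have t2 := hh.2.1 _ hFΘ hFΘc
    rw [hG] at t1 t2
    obtain ⟨M, hM⟩ := hF.continuous.bounded_above_of_compact_support hFc
    have hi1 : Integrable (fun x => F x * h x) μT :=
      hhi.bdd_mul hF.continuous.aestronglyMeasurable (ae_of_all _ hM)
    have hi2 : Integrable (fun x => F x * h (x.1, -x.2)) μT :=
      hhΘi.bdd_mul hF.continuous.aestronglyMeasurable (ae_of_all _ hM)
    have hcv : ∫ x, F (x.1, -x.2) * h x ∂μT = ∫ x, F x * h (x.1, -x.2) ∂μT := by
      have e := hmp.integral_comp' (fun y => F y * h (y.1, -y.2))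
      simp only [momentumReversal_apply, neg_neg, Prod.mk.eta] at e
      exact e
    have hlim : ∫ x, F x * h x ∂μT - ∫ x, F (x.1, -x.2) * h x ∂μT =
        ∫ x, F x * (h x - h (x.1, -x.2)) ∂μT := by
      rw [hcv, ← integral_sub hi1 hi2]
      refine integral_congr_ae (ae_of_all _ fun x => ?_)
      ring
    rw [← hlim]
    exact t1.sub t2
  have hae : (fun x => h x - h (x.1, -x.2)) =ᵐ[μT] d₀ :=
    ae_eq_of_tendsto_testFunction hhoi hd₀i hclause hclause₀
  -- (3) the constant: `∫ (h − h∘Θ)² dμ_{N,T,T} = ∫ d₀² dμ_T < D`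
  have hL : ∫ x, (h x - h (x.1, -x.2)) ^ 2 ∂μT = ∫ x, d₀ x ^ 2 ∂μT :=
    integral_congr_ae (by filter_upwards [hae] with x hx; rw [hx])
  rw [hG, hL] at hD
  -- (4) dominated convergence and conclusion
  have hlimq := tendsto_integral_oddQuot_sq_mul_exp hω hl.le hβ.le γ N hT hδ₀ hηT hφm hR2 hR3 hR0 hR4
  have hZ : Integrable (P.gibbsDensity N T) := pinnedChain_integrable_gibbsDensity hω hl.le hβ.le γ N hT
  have hcont : Continuous (P.gibbsDensity N T) := pinnedChain_continuous_gibbsDensity ω₂ lam β γ N T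
  filter_upwards [hlimq.eventually_lt_const hD, eventually_ne_and_abs_lt hδ₀] with δ hδD hδ
  obtain ⟨ρ, hρm, hρpos, hρeq, hlog⟩ := exists_density_of_gibbs_withDensity_exp P N T hZ hcont (hφm δ)
  have hμδ := hR1 δ hδ.1 hδ.2
  obtain ⟨hInt, hval⟩ := integral_sq_withDensity_exp μT (hφm δ) (fun x => φ δ x - φ δ (x.1, -x.2)) hδ.1
    (integrable_oddQuot_sq_mul_exp hω hl.le hβ.le γ N hT hηT (hφm δ) (hR2 δ hδ.2) hδ.1 (hR3 δ hδ.2))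
  refine ⟨ρ, hρm, hρpos, by rw [hμδ, hρeq], ?_, ?_⟩
  · rw [hμδ]
    simp_rw [hlog]
    exact hInt
  · rw [hμδ]
    simp_rw [hlog]
    rw [hval]
    nlinarith [hδD, sq_nonneg δ]

end Summit.AtomisticToContinuum.FouriersLaw.Theorems.ExtensiveSnapshotIrreversibility.ClausiusBudget

end
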